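import Summits.CriticalPhenomena.Ising3DConformalLimit.Theorems.PerfectScreeningSubharmonicOffOriginKlBandDefs
import Literature.Probability.LatticeModels.AxisSpectralRepresentationProofs

/-!
# Crux `PerfectScreening.SubharmonicOffOrigin` (stmt-CriticalPhenomena-1341), line
`kl-band-positivity`: helper 1/2 of stub `stub_jointSpectralMeasure` — the finite-torus JOINT
spectral sum of the periodic two-point function (transfer matrix AND transverse momentum)

Registered sub-goal `jointSpec_torusSum` (supports stmt-CriticalPhenomena-1341): on `(ℤ/Nℤ)^{d'+1}`,
`N ≥ 3`, `β > 0`, direction `i`, there are `λ_k ≥ 0` (eigenvalues of the symmetrised transfer matrix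
`A`) and weights `w_{qkl} ≥ 0` (`q` a transverse momentum, `k,l` eigen-indices) with
`⟨σ₀ σ_{ins_i(n,u)}⟩_{𝕋_N;β} = ∑_{q,k,l} w_{qkl} (λ_l/λ_k)ⁿ Re χ_q(u)` (`0 ≤ n < N`) and the uniform
no-atom bound `∑_{λ_l/λ_k ≤ δ} w_{qkl} ≤ B(β,d') δ²`.  Proof WITHOUT simultaneous diagonalisation:
(1) `jointSpec_spectralFamily` — in ONE eigenbasis `U` of `A` (spectral theorem, via
`Literature.LinearAlgebra.Matrix.PerronSymmetric`), `Tr(diag σ_{y'} Aⁿ diag σ_y Aᵐ) =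
∑_{k,l} M^{(y')}_{kl} M^{(y)}_{kl} λ_lⁿλ_kᵐ`, `M^{(y)} = Uᵀ diag σ_y U`, plus the tree's intertwiners
(`AxisSpectral.exists_intertwiner`) as `λ_k²(M^{(y)}_{kl})² = λ_l² c'^{(y)}_{kl}`, `∑_l c'^{(y)}_{kl} ≤ B`;
(2) translation invariance of the periodic state (`isingTorusTwoPoint_eq_zero_sub`) AVERAGES the
transfer representation (`sum_exp_mul_layerObs_eq_trace`) over the base point `y'`, so the
coefficient of `λ_lⁿλ_k^{N-n}` is the AUTOCORRELATION of `y ↦ M^{(y)}_{kl}` on `(ℤ/Nℤ)^{d'}`;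
(3) `jointSpec_autocorr_eq` (Bochner on a finite abelian group = character orthogonality,
`sum_torusChar_left`): `∑_y b(y)b(y+u) = N^{-d'} ∑_q |b̂(q)|² Re χ_q(u)`; at `u = 0` (Parseval) it turns
the intertwiner bound into the no-atom bound.  References: Glimm–Jaffe, *Quantum Physics* (1987)
§6.1; Aizenman–Duminil-Copin, Ann. of Math. 194 (2021) = arXiv:1912.07973, Prop. 5.3, App. Prop. 8.6;
Schultz–Mattis–Lieb, Rev. Mod. Phys. 36 (1964) §II (through `TorusTransferSpectral`).
-/
noncomputable section

open MeasureTheory ProbabilityTheory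
open Literature.Probability.LatticeModels

namespace Summit.CriticalPhenomena.Ising3DConformalLimit.Theorems.PerfectScreening.KlBand

open Matrix Finset Literature.LinearAlgebra.Matrix
open scoped ComplexConjugate

/-! ## 1. Spectral weights of a family of observables in one eigenbasis -/

/-- **Two-insertion traces of a FAMILY of diagonal observables in one eigenbasis, with
intertwiners.** For a positive semidefinite real symmetric `A`, observables `diag (f a)` and
matrices `S' a` with `diag (f a) · A = A · S' a`, `‖S' a v‖² ≤ B‖v‖²`: there are `λ_k ≥ 0`, real
`M a k l` (the matrix elements `(Uᵀ diag(f a) U)_{kl}`) and `c' a k l ≥ 0` with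
`Tr(diag(f a) Aⁿ diag(f b) Aᵐ) = ∑_{k,l} M a k l · M b k l · λ_lⁿ λ_kᵐ`, `Tr(Aᵐ) = ∑_k λ_kᵐ`,
`λ_k² (M a k l)² = λ_l² c' a k l` and `∑_l c' a k l ≤ B`. -/
theorem jointSpec_spectralFamily {ι κ : Type*} [Fintype ι] [DecidableEq ι] {A : Matrix ι ι ℝ}
    (hA : A.PosSemidef) (f : κ → ι → ℝ)
    (S' : κ → Matrix ι ι ℝ) (hS : ∀ a, diagonal (f a) * A = A * S' a) (B : ℝ)
    (hB : ∀ a (v : ι → ℝ), ∑ x, (S' a *ᵥ v) x ^ 2 ≤ B * ∑ x, v x ^ 2) :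
    ∃ (ev : ι → ℝ) (M c' : κ → ι → ι → ℝ), (∀ k, 0 ≤ ev k) ∧ (∀ a k l, 0 ≤ c' a k l) ∧
      (∀ a b (n m : ℕ), (diagonal (f a) * A ^ n * diagonal (f b) * A ^ m).trace =
        ∑ k, ∑ l, M a k l * M b k l * (ev l ^ n * ev k ^ m)) ∧
      (∀ m : ℕ, (A ^ m).trace = ∑ k, ev k ^ m) ∧
      (∀ a k l, ev k ^ 2 * M a k l ^ 2 = ev l ^ 2 * c' a k l) ∧
      (∀ a k, ∑ l, c' a k l ≤ B) := by
  classical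
  have hH : A.IsHermitian := hA.1
  set U : Matrix ι ι ℝ := eigU hH with hU
  set ev : ι → ℝ := hH.eigenvalues with hev
  have hUU : star U * U = 1 := star_eigU_mul hH
  have hUU' : U * star U = 1 := eigU_mul_star hH
  have hspec : ∀ m : ℕ, A ^ m = U * diagonal (fun i => ev i ^ m) * star U := pow_eq_eigU_mul hH
  have hspec1 : A = U * diagonal ev * star U := spectral_real hH
  -- the observables and the intertwiners in the eigenbasis
  set M : κ → Matrix ι ι ℝ := fun a => star U * diagonal (f a) * U with hM
  set M' : κ → Matrix ι ι ℝ := fun a => star U * S' a * U with hM'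
  have hMsym : ∀ a k l, M a k l = M a l k := by
    intro a k l
    simp only [hM, Matrix.mul_apply, Matrix.star_apply, star_trivial, Matrix.diagonal_apply, mul_ite,
      mul_zero, Finset.sum_ite_eq', Finset.mem_univ, if_true]
    exact Finset.sum_congr rfl fun x _ => by ring
  have hUAU : star U * A * U = diagonal ev := by
    rw [hspec1]
    calc star U * (U * diagonal ev * star U) * U
        = (star U * U) * diagonal ev * (star U * U) := by simp only [Matrix.mul_assoc]
      _ = diagonal ev := by rw [hUU, Matrix.one_mul, Matrix.mul_one]
  -- the intertwining relations in the eigenbasis: `M a Λ = Λ M' a`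
  have hMΛ : ∀ a, M a * diagonal ev = diagonal ev * M' a := by
    intro a
    have h1 : star U * (diagonal (f a) * A) * U = M a * diagonal ev := by
      calc star U * (diagonal (f a) * A) * U
          = star U * diagonal (f a) * (U * star U) * A * U := by
            rw [hUU', Matrix.mul_one]; simp only [Matrix.mul_assoc]
        _ = (star U * diagonal (f a) * U) * (star U * A * U) := by simp only [Matrix.mul_assoc]
        _ = M a * diagonal ev := by rw [hUAU]
    have h2 : star U * (A * S' a) * U = diagonal ev * M' a := by
      calc star U * (A * S' a) * U
          = star U * A * (U * star U) * S' a * U := by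
            rw [hUU', Matrix.mul_one]; simp only [Matrix.mul_assoc]
        _ = (star U * A * U) * (star U * S' a * U) := by simp only [Matrix.mul_assoc]
        _ = diagonal ev * M' a := by rw [hUAU]
    rw [← h1, ← h2, hS a]
  have hrel : ∀ a k l, M a k l * ev l = ev k * M' a k l := by
    intro a k l
    have h := congrFun (congrFun (hMΛ a) k) l
    rwa [Matrix.mul_diagonal, Matrix.diagonal_mul] at h
  refine ⟨ev, fun a k l => M a k l, fun a k l => M' a l k ^ 2, fun k => hA.eigenvalues_nonneg k,
    fun a k l => sq_nonneg _, fun a b n m => ?_, fun m => trace_pow_eq_sum hH m, fun a k l => ?_,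
    fun a k => ?_⟩
  · -- the two-insertion trace
    set Dn : Matrix ι ι ℝ := diagonal fun i => ev i ^ n with hDn
    set Dm : Matrix ι ι ℝ := diagonal fun i => ev i ^ m with hDm
    calc (diagonal (f a) * A ^ n * diagonal (f b) * A ^ m).trace
        = (diagonal (f a) * (U * Dn * star U) * diagonal (f b) * (U * Dm * star U)).trace := by
          rw [hspec n, hspec m]
      _ = ((diagonal (f a) * U * Dn * (star U * diagonal (f b) * U) * Dm) * star U).trace := by
          simp only [Matrix.mul_assoc]
      _ = (star U * (diagonal (f a) * U * Dn * (star U * diagonal (f b) * U) * Dm)).trace :=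
          Matrix.trace_mul_comm _ _
      _ = (M a * Dn * M b * Dm).trace := by simp only [hM, Matrix.mul_assoc]
      _ = ∑ k, ∑ l, M a k l * M b k l * (ev l ^ n * ev k ^ m) := by
          simp only [Matrix.trace, Matrix.diag_apply, hDm, hDn, Matrix.mul_apply, Matrix.diagonal_apply,
            mul_ite, mul_zero, Finset.sum_ite_eq', Finset.mem_univ, if_true, Finset.sum_mul]
          refine Finset.sum_congr rfl fun k _ => Finset.sum_congr rfl fun l _ => ?_
          rw [hMsym b k l]
          ring
  · -- `λ_k² (M a k l)² = λ_l² c' a k l`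
    show ev k ^ 2 * M a k l ^ 2 = ev l ^ 2 * M' a l k ^ 2
    have h := hrel a l k
    rw [hMsym a k l]
    calc ev k ^ 2 * M a l k ^ 2 = (M a l k * ev k) ^ 2 := by ring
      _ = (ev l * M' a l k) ^ 2 := by rw [h]
      _ = ev l ^ 2 * M' a l k ^ 2 := by ring
  · -- `∑_l c' a k l = ‖Uᵀ (S' a u_k)‖² = ‖S' a u_k‖² ≤ B ‖u_k‖² = B`
    show ∑ l, M' a l k ^ 2 ≤ B
    set u : ι → ℝ := fun x => U x k with hu
    have hcol : ∀ l, M' a l k = (star U *ᵥ (S' a *ᵥ u)) l := by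
      intro l
      simp only [hM', hu, Matrix.mul_apply, Matrix.mulVec, dotProduct, Matrix.star_apply, star_trivial,
        Finset.sum_mul]
      rw [Finset.sum_comm]
      refine Finset.sum_congr rfl fun x _ => ?_
      rw [Finset.mul_sum]
      refine Finset.sum_congr rfl fun x' _ => ?_
      ring
    have hnorm : ∑ l, (star U *ᵥ (S' a *ᵥ u)) l ^ 2 = ∑ x, (S' a *ᵥ u) x ^ 2 := by
      rw [← dotProduct_self_eq_sum hH (S' a *ᵥ u)]
      simp only [dotProduct]
      exact Finset.sum_congr rfl fun x _ => by ring
    have hunit : ∑ x, u x ^ 2 = 1 := by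
      have h := congrFun (congrFun hUU k) k
      simp only [Matrix.mul_apply, Matrix.star_apply, star_trivial, Matrix.one_apply_eq] at h
      rw [← h]
      exact Finset.sum_congr rfl fun x _ => by rw [hu, sq]
    calc ∑ l, M' a l k ^ 2 = ∑ x, (S' a *ᵥ u) x ^ 2 := (Finset.sum_congr rfl fun l _ => by rw [hcol l]).trans hnorm
      _ ≤ B * ∑ x, u x ^ 2 := hB a u
      _ = B := by rw [hunit, mul_one]

/-! ## 2. Autocorrelations on `(ℤ/Nℤ)^{d'}` are positive-definite: finite Fourier inversion -/

/-- **Autocorrelation through the finite Fourier transform** (Bochner's theorem on the finite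
abelian group `(ℤ/Nℤ)^{d'}`, i.e. character orthogonality): for a real function `b` on the layer
and a shift `u`, `∑_y b(y) b(y+u) = N^{-d'} ∑_q ‖∑_y b(y) χ_q(y)‖² · Re χ_q(u)`.  At `u = 0` this is
Parseval. -/
theorem jointSpec_autocorr_eq {d' N : ℕ} [NeZero N] (b : TorusSite d' N → ℝ) (u : TorusSite d' N) :
    ∑ y, b y * b (y + u) =
      ((N : ℝ) ^ d')⁻¹ * ∑ q, ‖∑ y, (b y : ℂ) * torusChar q y‖ ^ 2 * (torusChar q u).re := by
  classical
  -- the complex identity `∑_q conj(b̂ q) b̂ q conj χ_q(u) = N^{d'} ∑_y b y b (y+u)`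
  have hexp : ∀ q : TorusSite d' N,
      conj (∑ y, (b y : ℂ) * torusChar q y) * (∑ y, (b y : ℂ) * torusChar q y) * conj (torusChar q u) =
        ∑ y, ∑ y', (b y : ℂ) * (b y' : ℂ) * torusChar q (y' - y - u) := by
    intro q
    rw [map_sum, Finset.sum_mul_sum, Finset.sum_mul]
    refine Finset.sum_congr rfl fun y _ => ?_
    rw [Finset.sum_mul]
    refine Finset.sum_congr rfl fun y' _ => ?_
    rw [map_mul, Complex.conj_ofReal, torusChar_sub_right, torusChar_sub_right]
    ring
  have key : ∑ q : TorusSite d' N,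
      conj (∑ y, (b y : ℂ) * torusChar q y) * (∑ y, (b y : ℂ) * torusChar q y) * conj (torusChar q u) =
        (N : ℂ) ^ d' * ((∑ y, b y * b (y + u) : ℝ) : ℂ) := by
    simp_rw [hexp]
    rw [Finset.sum_comm]
    push_cast
    rw [Finset.mul_sum]
    refine Finset.sum_congr rfl fun y _ => ?_
    rw [Finset.sum_comm]
    have h1 : ∀ y' : TorusSite d' N, ∑ q : TorusSite d' N, (b y : ℂ) * (b y' : ℂ) * torusChar q (y' - y - u) =
        (b y : ℂ) * (b y' : ℂ) * (if y' - y - u = 0 then (N : ℂ) ^ d' else 0) := fun y' => by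
      rw [← Finset.mul_sum, sum_torusChar_left]
    simp_rw [h1]
    rw [Finset.sum_eq_single (y + u)]
    · rw [if_pos (show y + u - y - u = 0 by abel)]
      ring
    · intro y' _ hy'
      rw [if_neg (fun h => hy' ?_), mul_zero]
      rwa [sub_sub, sub_eq_zero] at h
    · exact fun h => absurd (Finset.mem_univ _) h
  -- take real parts
  have hre := congrArg Complex.re key
  simp_rw [← Complex.normSq_eq_conj_mul_self, Complex.normSq_eq_norm_sq, Complex.re_sum,
    Complex.re_ofReal_mul, Complex.conj_re] at hre
  rw [show ((N : ℂ) ^ d' * ((∑ y, b y * b (y + u) : ℝ) : ℂ)).re = (N : ℝ) ^ d' * ∑ y, b y * b (y + u) by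
    rw [← Complex.ofReal_natCast, ← Complex.ofReal_pow, ← Complex.ofReal_mul, Complex.ofReal_re]] at hre
  have hN : ((N : ℝ) ^ d') ≠ 0 := pow_ne_zero _ (Nat.cast_ne_zero.2 (NeZero.ne N))
  rw [hre, ← mul_assoc, inv_mul_cancel₀ hN, one_mul]

/-! ## 3. The joint spectral sum of the periodic two-point function -/

/-- Transverse differences of layer sites: `ins_i(n, y' + u) − ins_i(0, y') = ins_i(n, u)`. -/
theorem jointSpec_ins_sub_ins {d' N : ℕ} (i : Fin (d' + 1)) (n : ZMod N) (y' u : TorusSite d' N) :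
    Torus.ins i n (y' + u) - Torus.ins i 0 y' = Torus.ins i n u := by
  funext x
  exact Fin.succAboveCases i (by simp) (fun j => by simp) x

/-- **The joint spectral sum on the torus** (registered sub-goal `jointSpec_torusSum` of
stmt-CriticalPhenomena-1341): for `β > 0` there is `B = B(β,d') ≥ 0` such that on every torus
`(ℤ/Nℤ)^{d'+1}`, `N ≥ 3`, in every direction `i`, there are `λ_k ≥ 0` and weights `w_{qkl} ≥ 0` with
`⟨σ₀ σ_{ins_i(n,u)}⟩_{𝕋_N;β} = ∑_{q,k,l} w_{qkl} (λ_l/λ_k)ⁿ Re χ_q(u)` for `0 ≤ n < N`, all `u`, and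
`∑_{q,k,l : λ_l/λ_k ≤ δ} w_{qkl} ≤ B δ²` for all `δ ≥ 0`. -/
theorem jointSpec_torusSum :
    ∀ {β : ℝ}, 0 < β → ∀ (d' : ℕ), ∃ B : ℝ, 0 ≤ B ∧ ∀ (N : ℕ) [NeZero N], 3 ≤ N → ∀ i : Fin (d' + 1),
      ∃ (ev : Layer d' N → ℝ) (w : TorusSite d' N → Layer d' N → Layer d' N → ℝ),
        (∀ k, 0 ≤ ev k) ∧ (∀ q k l, 0 ≤ w q k l) ∧
        (∀ n : ℕ, n < N → ∀ u : TorusSite d' N,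
          isingTorusTwoPoint (d' + 1) N β 0 0 (Torus.ins i (n : ZMod N) u) =
            ∑ q, ∑ k, ∑ l, w q k l * (ev l / ev k) ^ n * (torusChar q u).re) ∧
        (∀ δ : ℝ, 0 ≤ δ →
          ∑ q, ∑ k, ∑ l, (if ev l / ev k ≤ δ then w q k l else 0) ≤ B * δ ^ 2) := by
  intro β hβ d'
  set B : ℝ := (2 * ((1 + Real.exp (-2 * β) ^ 2) ^ 2 +
      4 * Real.exp (-2 * β) ^ 2 * Real.exp (2 * β * d') ^ 2) / (1 - Real.exp (-2 * β) ^ 2) ^ 2) with hBdef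
  refine ⟨B, by positivity, fun N _ hN i => ?_⟩
  classical
  set A := transferMatrix (d' := d') (N := N) β 0 with hAdef
  have hA : A.PosSemidef := transferMatrix_posSemidef hβ.le 0
  -- intertwiners at every site of the layer, with the uniform bound `B` (Part B of the axis file)
  choose S' hS' hS'B using fun y : TorusSite d' N => AxisSpectral.exists_intertwiner (N := N) hβ y
  obtain ⟨ev, M, c', hev, hc', htrace, htrpow, hrel, hsumc'⟩ :=
    jointSpec_spectralFamily hA (fun (y : TorusSite d' N) (r : Layer d' N) => spinAt y r) S' hS' B hS'B
  -- the partition function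
  set Z := isingPartitionFunction (torusGraph (d' + 1) N) Finset.univ β 0 .free with hZdef
  have hZpos : 0 < Z := isingPartitionFunction_pos _ _ β 0 _
  -- (1) two-point functions of layer spins are two-insertion traces
  have htwo : ∀ (y' y : TorusSite d' N) (n : ZMod N),
      Z * isingTorusTwoPoint (d' + 1) N β 0 (Torus.ins i 0 y') (Torus.ins i n y) =
        ∑ k, ∑ l, M y' k l * M y k l * (ev l ^ n.val * ev k ^ (N - n.val)) := by
    intro y' y n
    have e1 := sum_exp_mul_layerObs_eq_trace hN i β 0 (fun r => spinAt y' r) (fun r => spinAt y r) n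
    rw [isingTorusTwoPoint_eq_sum, ← mul_assoc, mul_inv_cancel₀ hZpos.ne', one_mul,
      ← htrace y' y n.val (N - n.val), ← e1]
    rfl
  -- `Z = Tr A^N = ∑_k λ_k^N`
  have hZev : Z = ∑ k, ev k ^ N := by
    have h1 : isingTorusTwoPoint (d' + 1) N β 0 (Torus.ins i 0 (0 : TorusSite d' N))
        (Torus.ins i 0 (0 : TorusSite d' N)) = 1 := by
      simp [isingTorusTwoPoint]
    have h2 := htwo 0 0 0
    rw [h1, mul_one, ← htrace, ZMod.val_zero, Nat.sub_zero, pow_zero, Matrix.mul_one,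
      diagonal_mul_diagonal] at h2
    have h3 : (fun r : Layer d' N => spinAt (0 : TorusSite d' N) r * spinAt 0 r) = fun _ => (1 : ℝ) :=
      funext fun r => spinAt_mul_self 0 r
    rw [h3, diagonal_one, Matrix.one_mul, htrpow] at h2
    exact h2
  -- (2) translation invariance and averaging over the base point of the layer
  have hcard : (Fintype.card (TorusSite d' N) : ℝ) = (N : ℝ) ^ d' := by
    rw [Fintype.card_fun, ZMod.card, Fintype.card_fin, Nat.cast_pow]
  have hNd : ((N : ℝ) ^ d') ≠ 0 := pow_ne_zero _ (Nat.cast_ne_zero.2 (NeZero.ne N))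
  have havg : ∀ n : ℕ, n < N → ∀ u : TorusSite d' N,
      (N : ℝ) ^ d' * (Z * isingTorusTwoPoint (d' + 1) N β 0 0 (Torus.ins i (n : ZMod N) u)) =
        ∑ k, ∑ l, (∑ y', M y' k l * M (y' + u) k l) * (ev l ^ n * ev k ^ (N - n)) := by
    intro n hn u
    have hval : ((n : ℕ) : ZMod N).val = n := ZMod.val_cast_of_lt hn
    have hy' : ∀ y' : TorusSite d' N, Z * isingTorusTwoPoint (d' + 1) N β 0 0 (Torus.ins i (n : ZMod N) u) =
        ∑ k, ∑ l, M y' k l * M (y' + u) k l * (ev l ^ n * ev k ^ (N - n)) := by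
      intro y'
      rw [← jointSpec_ins_sub_ins i (n : ZMod N) y' u, ← isingTorusTwoPoint_eq_zero_sub, htwo, hval]
    calc (N : ℝ) ^ d' * (Z * isingTorusTwoPoint (d' + 1) N β 0 0 (Torus.ins i (n : ZMod N) u))
        = ∑ _y' : TorusSite d' N, Z * isingTorusTwoPoint (d' + 1) N β 0 0 (Torus.ins i (n : ZMod N) u) := by
          rw [Finset.sum_const, Finset.card_univ, nsmul_eq_mul, hcard]
      _ = ∑ y', ∑ k, ∑ l, M y' k l * M (y' + u) k l * (ev l ^ n * ev k ^ (N - n)) :=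
          Finset.sum_congr rfl fun y' _ => hy' y'
      _ = ∑ k, ∑ y', ∑ l, M y' k l * M (y' + u) k l * (ev l ^ n * ev k ^ (N - n)) := Finset.sum_comm
      _ = ∑ k, ∑ l, (∑ y', M y' k l * M (y' + u) k l) * (ev l ^ n * ev k ^ (N - n)) := by
          refine Finset.sum_congr rfl fun k _ => ?_
          rw [Finset.sum_comm]
          refine Finset.sum_congr rfl fun l _ => ?_
          rw [Finset.sum_mul]
  -- the weights
  set F : TorusSite d' N → Layer d' N → Layer d' N → ℝ :=
    fun q k l => ‖∑ y, (M y k l : ℂ) * torusChar q y‖ ^ 2 with hF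
  set w : TorusSite d' N → Layer d' N → Layer d' N → ℝ :=
    fun q k l => F q k l * ev k ^ N / ((N : ℝ) ^ d' * (N : ℝ) ^ d' * Z) with hw
  have hF0 : ∀ q k l, 0 ≤ F q k l := fun q k l => sq_nonneg _
  have hNpos : (0 : ℝ) < (N : ℝ) ^ d' := pow_pos (Nat.cast_pos.2 (Nat.pos_of_ne_zero (NeZero.ne N))) d'
  have hden : 0 < (N : ℝ) ^ d' * (N : ℝ) ^ d' * Z := mul_pos (mul_pos hNpos hNpos) hZpos
  have hCnn : 0 ≤ ((N : ℝ) ^ d' * Z)⁻¹ := inv_nonneg.2 (mul_pos hNpos hZpos).le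
  -- autocorrelations of the matrix elements through the finite Fourier transform
  have hauto : ∀ (k l : Layer d' N) (u : TorusSite d' N),
      ∑ y', M y' k l * M (y' + u) k l = ((N : ℝ) ^ d')⁻¹ * ∑ q, F q k l * (torusChar q u).re :=
    fun k l u => jointSpec_autocorr_eq (fun y => M y k l) u
  have hw0 : ∀ q k l, 0 ≤ w q k l := fun q k l =>
    div_nonneg (mul_nonneg (hF0 q k l) (pow_nonneg (hev k) N)) hden.le
  -- Parseval: `∑_q F q k l = N^{d'} ∑_y (M y k l)²`
  have hpars : ∀ k l, ∑ q, F q k l = (N : ℝ) ^ d' * ∑ y, M y k l ^ 2 := by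
    intro k l
    have h := hauto k l 0
    simp only [add_zero, torusChar_zero_right, Complex.one_re, mul_one] at h
    rw [← mul_right_inj' hNd, ← mul_assoc, mul_inv_cancel₀ hNd, one_mul] at h
    rw [← h]
    congr 1
    exact Finset.sum_congr rfl fun y _ => by rw [sq]
  refine ⟨ev, w, hev, hw0, fun n hn u => ?_, fun δ hδ => ?_⟩
  · -- the representation
    have key := havg n hn u
    simp_rw [hauto] at key
    have hterm : ∀ q k l, w q k l * (ev l / ev k) ^ n * (torusChar q u).re =
        ((N : ℝ) ^ d' * (N : ℝ) ^ d' * Z)⁻¹ *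
          (F q k l * (torusChar q u).re * (ev l ^ n * ev k ^ (N - n))) := by
      intro q k l
      simp only [hw]
      rcases (hev k).eq_or_lt with hk | hk
      · rw [← hk, zero_pow (by omega : N ≠ 0), zero_pow (by omega : N - n ≠ 0)]; simp
      · rw [div_pow]
        have hsplit : ev k ^ N = ev k ^ n * ev k ^ (N - n) := by rw [← pow_add]; congr 1; omega
        rw [hsplit]
        field_simp
    simp_rw [hterm, ← Finset.mul_sum]
    rw [eq_inv_mul_iff_mul_eq₀ hden.ne']
    calc (N : ℝ) ^ d' * (N : ℝ) ^ d' * Z * isingTorusTwoPoint (d' + 1) N β 0 0 (Torus.ins i (n : ZMod N) u)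
        = (N : ℝ) ^ d' * ((N : ℝ) ^ d' * (Z * isingTorusTwoPoint (d' + 1) N β 0 0 (Torus.ins i (n : ZMod N) u))) := by
          ring
      _ = (N : ℝ) ^ d' * ∑ k, ∑ l, (((N : ℝ) ^ d')⁻¹ * ∑ q, F q k l * (torusChar q u).re) *
            (ev l ^ n * ev k ^ (N - n)) := by rw [key]
      _ = ∑ k, ∑ l, (∑ q, F q k l * (torusChar q u).re) * (ev l ^ n * ev k ^ (N - n)) := by
          rw [Finset.mul_sum]
          refine Finset.sum_congr rfl fun k _ => ?_
          rw [Finset.mul_sum]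
          refine Finset.sum_congr rfl fun l _ => ?_
          field_simp
      _ = ∑ q, ∑ k, ∑ l, F q k l * (torusChar q u).re * (ev l ^ n * ev k ^ (N - n)) := by
          symm
          rw [Finset.sum_comm]
          refine Finset.sum_congr rfl fun k _ => ?_
          rw [Finset.sum_comm]
          refine Finset.sum_congr rfl fun l _ => ?_
          rw [Finset.sum_mul]
  · -- the uniform bound on the small ratios
    have hM2 : ∀ y k l, ev l / ev k ≤ δ → ev k ^ N * M y k l ^ 2 ≤ ev k ^ N * (δ ^ 2 * c' y k l) := by
      intro y k l hx
      rcases (hev k).eq_or_lt with hk | hk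
      · rw [← hk, zero_pow (by omega : N ≠ 0), zero_mul, zero_mul]
      · refine mul_le_mul_of_nonneg_left ?_ (pow_nonneg (hev k) N)
        have h := hrel y k l
        have hx0 : 0 ≤ ev l / ev k := div_nonneg (hev l) hk.le
        have hM : M y k l ^ 2 = (ev l / ev k) ^ 2 * c' y k l := by
          field_simp
          linarith [h]
        rw [hM]
        exact mul_le_mul_of_nonneg_right (pow_le_pow_left₀ hx0 hx 2) (hc' y k l)
    -- move the momentum sum inside and use Parseval
    have hstep : ∀ k l, ∑ q, (if ev l / ev k ≤ δ then w q k l else 0) ≤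
        ((N : ℝ) ^ d' * Z)⁻¹ * (ev k ^ N * (δ ^ 2 * ∑ y, c' y k l)) := by
      intro k l
      by_cases hx : ev l / ev k ≤ δ
      · simp only [if_pos hx, hw]
        rw [← Finset.sum_div, ← Finset.sum_mul, hpars k l]
        have h1 : (N : ℝ) ^ d' * (∑ y, M y k l ^ 2) * ev k ^ N / ((N : ℝ) ^ d' * (N : ℝ) ^ d' * Z) =
            ((N : ℝ) ^ d' * Z)⁻¹ * ∑ y, ev k ^ N * M y k l ^ 2 := by
          rw [← Finset.mul_sum]
          field_simp
        rw [h1]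
        refine mul_le_mul_of_nonneg_left ?_ hCnn
        rw [Finset.mul_sum, Finset.mul_sum]
        exact Finset.sum_le_sum fun y _ => hM2 y k l hx
      · simp only [if_neg hx, Finset.sum_const_zero]
        exact mul_nonneg hCnn (mul_nonneg (pow_nonneg (hev k) N)
          (mul_nonneg (sq_nonneg δ) (Finset.sum_nonneg fun y _ => hc' y k l)))
    have hk : ∀ k, ∑ l, ((N : ℝ) ^ d' * Z)⁻¹ * (ev k ^ N * (δ ^ 2 * ∑ y, c' y k l)) ≤
        ((N : ℝ) ^ d' * Z)⁻¹ * (ev k ^ N * (δ ^ 2 * ((N : ℝ) ^ d' * B))) := by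
      intro k
      rw [← Finset.mul_sum, ← Finset.mul_sum, ← Finset.mul_sum]
      refine mul_le_mul_of_nonneg_left (mul_le_mul_of_nonneg_left
        (mul_le_mul_of_nonneg_left ?_ (sq_nonneg δ)) (pow_nonneg (hev k) N)) hCnn
      rw [Finset.sum_comm]
      calc ∑ y, ∑ l, c' y k l ≤ ∑ _y : TorusSite d' N, B := Finset.sum_le_sum fun y _ => hsumc' y k
        _ = (N : ℝ) ^ d' * B := by rw [Finset.sum_const, Finset.card_univ, nsmul_eq_mul, hcard]
    calc ∑ q, ∑ k, ∑ l, (if ev l / ev k ≤ δ then w q k l else 0)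
        = ∑ k, ∑ l, ∑ q, (if ev l / ev k ≤ δ then w q k l else 0) := by
          rw [Finset.sum_comm]
          exact Finset.sum_congr rfl fun k _ => Finset.sum_comm
      _ ≤ ∑ k, ∑ l, ((N : ℝ) ^ d' * Z)⁻¹ * (ev k ^ N * (δ ^ 2 * ∑ y, c' y k l)) :=
          Finset.sum_le_sum fun k _ => Finset.sum_le_sum fun l _ => hstep k l
      _ ≤ ∑ k, ((N : ℝ) ^ d' * Z)⁻¹ * (ev k ^ N * (δ ^ 2 * ((N : ℝ) ^ d' * B))) :=
          Finset.sum_le_sum fun k _ => hk k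
      _ = B * δ ^ 2 := by
          rw [← Finset.mul_sum, ← Finset.sum_mul, ← hZev]
          field_simp

end Summit.CriticalPhenomena.Ising3DConformalLimit.Theorems.PerfectScreening.KlBand

end
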